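import Summits.Ventures.CertifiedManyBodySolver.Downfold.BoxesLa214TpLadderAxialSlabs
import Summits.Ventures.CertifiedManyBodySolver.Downfold.EmeryAxialSlabLa214
import HarnessLib

/-!
# `t′` ladder of La₂₋ₓSrₓCuO₄ (box #18), part 6 (ties): the EXCLUSION words of part 6 as `HoldsOn` statements on the companion of record `emeryBoxLa214v123`,
# each ONE application of mod-4's slab certificate `Emery.emeryBoxLa214v123_axSlab{1,4,5,6}` (`EmeryAxialSlabLa214`, p712978)

Venture CertifiedManyBodySolver, cell `pub/hubbard-downfold` (D-0154 (1)(C) COVERAGE, La214 TEMPLATE material; seat `hubbard-cov-la214-unc-3`, seventh seat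
(`prover-hubbard-cov-la214-unc-3-g6-0`), lane `t′`); namespace `Summit.Ventures.CertifiedManyBodySolver.Downfold`. Split off part 6 (`BoxesLa214TpLadderAxialSlabs`, the
typed slab table and the placement arithmetic) only because it must import the device's file. Everything here is PROVED; every statement is an EXCLUSION (a value outside a
certified outer enclosure is attained by no companion point at the stated co-shift and filling):
* §1 for every co-shift a ∈ [1/4, 3/10] or a ∈ [3/10, 2/5] NO parameter vector of `emeryBoxLa214v123` at n_H = 1 has a co-shifted σ-model (≡ four-orbital, by mod-4's transfer
  theorem) Fermi-surface ratio equal to any of the twelve located in-house object-E refits `la214E_tp_x0_dets`; for a ∈ [1/5, 1/4] none equals the three weakest refits;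
* §2 for every co-shift a ∈ [1/20, 1/10] the ratio lies strictly below the literature object-M row's low end `−9/50` — it equals no located one-body object-M print and is not
  an object-M row value.
HONEST FRAMING: SCREENING-GRADE companion box; MODEL-FORM (σ + axial co-shift) REDUCTION STEP only (mod-4's certificates); typed numbers on a typed box, not statements about
La₂CuO₄ samples; no row, END, FLOOR, word, bar, leaf, node or coverage statement moves; no phase sentence; no summit statement is proved by this seat.
References: [AndersenEtAl1995, §§5–6]; [PavariniEtAl2001, Eqs. (1)–(3)]; [HybertsenSchluterChristensen1989, Eq. (1)].
-/

noncomputable section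

namespace Summit.Ventures.CertifiedManyBodySolver.Downfold

open Set NonemptyInterval

/-! ## §1 The located in-house refits are excluded for a ≥ 1/4 (all twelve) and a ∈ [1/5, 1/4] (the three weakest) -/

/-- **SLAB 5 (a ∈ [1/4, 3/10]) EXCLUDES EVERY LOCATED x = 0 REFIT**: one application of `Emery.emeryBoxLa214v123_axSlab5` (window `[−1081/2500, −261/1000]`) and the
typed fact that every member of `la214E_tp_x0_dets` is `≥ −13/50 > −261/1000`. [cite: AndersenEtAl1995, §§5–6 (four-orbital axial model)] -/
theorem la214_tp_axialSlab5_memberFree_of_certificate :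
    HoldsOn (fun p : EmeryCoord → ℝ => ∀ a ε : ℝ, a ∈ Set.Icc (1 / 4 : ℝ) (3 / 10 : ℝ) →
      Emery.abFilling (p .DeltaPd) (p .tpd) (p .tpp + a) (p .tppP + a) ε = (2 - p .nHoles) / 2 →
      ∀ m ∈ la214E_tp_x0_dets, Emery.fsRatio (p .DeltaPd) (p .tpd) (p .tpp + a) (p .tppP + a) ε ≠ ((m : ℚ) : ℝ)) emeryBoxLa214v123 := by
  intro p hp a ε ha hf m hm heq
  have h := (Emery.emeryBoxLa214v123_axSlab5 p hp a ε ha hf).2.2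
  obtain ⟨hm1, -⟩ := la214E_tp_x0_dets_mem_hull m hm
  simp only [la214E_tp_x0_hull] at hm1
  have hm1' : ((-13/50 : ℚ) : ℝ) ≤ ((m : ℚ) : ℝ) := by exact_mod_cast hm1
  rw [heq] at h
  push_cast at hm1'
  linarith

/-- **SLAB 6 (a ∈ [3/10, 2/5]) EXCLUDES EVERY LOCATED x = 0 REFIT** (`Emery.emeryBoxLa214v123_axSlab6`, window `[−2359/5000, −687/2500]`). [cite: AndersenEtAl1995, §§5–6 (four-orbital axial model)] -/
theorem la214_tp_axialSlab6_memberFree_of_certificate :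
    HoldsOn (fun p : EmeryCoord → ℝ => ∀ a ε : ℝ, a ∈ Set.Icc (3 / 10 : ℝ) (2 / 5 : ℝ) →
      Emery.abFilling (p .DeltaPd) (p .tpd) (p .tpp + a) (p .tppP + a) ε = (2 - p .nHoles) / 2 →
      ∀ m ∈ la214E_tp_x0_dets, Emery.fsRatio (p .DeltaPd) (p .tpd) (p .tpp + a) (p .tppP + a) ε ≠ ((m : ℚ) : ℝ)) emeryBoxLa214v123 := by
  intro p hp a ε ha hf m hm heq
  have h := (Emery.emeryBoxLa214v123_axSlab6 p hp a ε ha hf).2.2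
  obtain ⟨hm1, -⟩ := la214E_tp_x0_dets_mem_hull m hm
  simp only [la214E_tp_x0_hull] at hm1
  have hm1' : ((-13/50 : ℚ) : ℝ) ≤ ((m : ℚ) : ℝ) := by exact_mod_cast hm1
  rw [heq] at h
  push_cast at hm1'
  linarith

/-- **SLAB 4 (a ∈ [1/5, 1/4]) EXCLUDES THE THREE WEAKEST LOCATED REFITS** `−241/1000`, `−61/250`, `−119/500` (`Emery.emeryBoxLa214v123_axSlab4`, window
`[−258/625, −307/1250]`; the other nine members are not excluded — part 6 §1). [cite: AndersenEtAl1995, §§5–6 (four-orbital axial model)] -/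
theorem la214_tp_axialSlab4_weakMembers_excluded_of_certificate :
    HoldsOn (fun p : EmeryCoord → ℝ => ∀ a ε : ℝ, a ∈ Set.Icc (1 / 5 : ℝ) (1 / 4 : ℝ) →
      Emery.abFilling (p .DeltaPd) (p .tpd) (p .tpp + a) (p .tppP + a) ε = (2 - p .nHoles) / 2 →
      ∀ m ∈ [(-241/1000 : ℚ), -61/250, -119/500], Emery.fsRatio (p .DeltaPd) (p .tpd) (p .tpp + a) (p .tppP + a) ε ≠ ((m : ℚ) : ℝ)) emeryBoxLa214v123 := by
  intro p hp a ε ha hf m hm heq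
  have h := (Emery.emeryBoxLa214v123_axSlab4 p hp a ε ha hf).2.2
  have hm1 : (-307/1250 : ℚ) < m := by
    revert m; simp only [List.forall_mem_cons]; norm_num
  have hm1' : ((-307/1250 : ℚ) : ℝ) < ((m : ℚ) : ℝ) := by exact_mod_cast hm1
  rw [heq] at h
  push_cast at hm1'
  linarith

/-! ## §2 Any co-shift a ∈ [1/20, 1/10] separates the Fermi-surface ratio from the one-body object-M row -/

/-- **SLAB 1 (a ∈ [1/20, 1/10]) EXCLUDES THE OBJECT-M ROWS AND PRINTS**: the ratio is `≤ −1881/10000 < −9/50`, so it lies outside the literature object-M row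
`la214M_tp_lit_row = [−9/50, −3/50]`, outside the typed row `la214M_M15v19_tp = [−17/100, −3/100]`, and equals none of the eight located one-body object-M prints
`la214M_tp_lit_dets ++ la214M_tp_lit_dets2` (`Emery.emeryBoxLa214v123_axSlab1`). [cite: PavariniEtAl2001, Eqs. (1)–(3)] -/
theorem la214_tp_axialSlab1_objectM_excluded_of_certificate :
    HoldsOn (fun p : EmeryCoord → ℝ => ∀ a ε : ℝ, a ∈ Set.Icc (1 / 20 : ℝ) (1 / 10 : ℝ) →
      Emery.abFilling (p .DeltaPd) (p .tpd) (p .tpp + a) (p .tppP + a) ε = (2 - p .nHoles) / 2 →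
      Emery.fsRatio (p .DeltaPd) (p .tpd) (p .tpp + a) (p .tppP + a) ε < ((la214M_tp_lit_row.fst : ℚ) : ℝ) ∧
        ¬ la214M_M15v19_tp.Mem (Emery.fsRatio (p .DeltaPd) (p .tpd) (p .tpp + a) (p .tppP + a) ε) ∧
        ∀ m ∈ la214M_tp_lit_dets ++ la214M_tp_lit_dets2,
          Emery.fsRatio (p .DeltaPd) (p .tpd) (p .tpp + a) (p .tppP + a) ε ≠ ((m : ℚ) : ℝ)) emeryBoxLa214v123 := by
  intro p hp a ε ha hf
  have h := (Emery.emeryBoxLa214v123_axSlab1 p hp a ε ha hf).2.2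
  refine ⟨?_, fun hM => ?_, fun m hm heq => ?_⟩
  · simp only [la214M_tp_lit_row]; push_cast; linarith
  · rw [la214M_M15v19_tp, Entry.mem_ofEnds_iff'] at hM
    have h1 := hM.1
    push_cast at h1
    linarith
  · have hm1 : (-9/50 : ℚ) < m := by
      revert m
      simp only [la214M_tp_lit_dets, la214M_tp_lit_dets2, List.cons_append, List.nil_append, List.forall_mem_cons]
      norm_num
    have hm1' : ((-9/50 : ℚ) : ℝ) < ((m : ℚ) : ℝ) := by exact_mod_cast hm1
    rw [heq] at h
    push_cast at hm1'
    linarith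

/-- **One citable line**: on the companion of record at n_H = 1, for every axial co-shift a ∈ [1/4, 2/5] no co-shifted σ (four-orbital) Fermi-surface ratio equals a
located in-house object-E refit. [folklore] -/
theorem la214_tp_axialSlabs_memberFree_of_certificates :
    HoldsOn (fun p : EmeryCoord → ℝ => ∀ a ε : ℝ, a ∈ Set.Icc (1 / 4 : ℝ) (2 / 5 : ℝ) →
      Emery.abFilling (p .DeltaPd) (p .tpd) (p .tpp + a) (p .tppP + a) ε = (2 - p .nHoles) / 2 →
      ∀ m ∈ la214E_tp_x0_dets, Emery.fsRatio (p .DeltaPd) (p .tpd) (p .tpp + a) (p .tppP + a) ε ≠ ((m : ℚ) : ℝ)) emeryBoxLa214v123 := by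
  intro p hp a ε ha hf m hm
  rcases le_or_gt a (3 / 10 : ℝ) with ha' | ha'
  · exact la214_tp_axialSlab5_memberFree_of_certificate p hp a ε ⟨ha.1, ha'⟩ hf m hm
  · exact la214_tp_axialSlab6_memberFree_of_certificate p hp a ε ⟨ha'.le, ha.2⟩ hf m hm

end Summit.Ventures.CertifiedManyBodySolver.Downfold

end
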